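import Literature.NumberTheory.GaloisRepresentations.OddAbsolutelyIrreducibleProofs
import Literature.NumberTheory.QuadraticFields.DiscriminantCharacter
import Summits.BirchSwinnertonDyer.Rank1Residual.X12.CMIrreducible
import Mathlib.NumberTheory.LSeries.PrimesInAP
import HarnessLib

set_option linter.dupNamespace false -- `Summit.BirchSwinnertonDyer.BirchSwinnertonDyer.Theorems.…` (summit = sub)
set_option autoImplicit false

/-!
# Crux (E♭°) `EisensteinDivisibilityCMInertBadFlatAtOne` (stmt-BirchSwinnertonDyer-20452), line `birth`:
# TOOLS for the (Irr) binder — a two-element criterion for absolute irreducibility in dimension two, and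
# Dirichlet primes copying the quadratic characters of `p`

Route `BiquadraticEisensteinDescent` (cell `pub/bsd-wall`, lead-prover seat `bsd-wall-bed-p1`, g3). The landed
helpers of line `birth` (p519061 `…FlatAtOneStubE2`, p520683 `…FlatAtOneOfFacts`) carry hypothesis (2) of Hsieh's
Theorem B (Doc. Math. 19 (2014) p. 712) as an undischarged binder (Irr) — every framing of `E_{K′}[p]` absolutely
irreducible. The companion file `…FlatAtOneAbsIrr` PROVES (Irr) for a CM curve at an inert bad `p ≥ 5` over every
Heegner field `K′` by a two-Frobenius criterion inside `Γ_{K′}`; this file holds its two field-independent tools: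

* §1 `isAbsolutelyIrreducible_of_involution_of_rootless` / `isAbsolutelyIrreducible_of_charpoly` — over a field `A`
  with `2 ≠ 0`, a plane representation `ρ : G →ₜ* GL₂(A)` containing a matrix `M₃` with `M₃² = 1`, `det M₃ = −1`
  (equivalently `charpoly = X² − 1`) and a matrix `M₁` whose characteristic polynomial has no root in `A` (e.g.
  `X² − x`, `x` a non-square) is absolutely irreducible: an invariant line after base change is `M₃`-stable, hence
  one of the two `A`-RATIONAL eigenlines of `M₃`, hence spanned by an `A`-eigenvector of `M₁`. The proof is the
  tree's `FramedRep.isAbsolutelyIrreducible_of_isIrreducible_of_det_eq_neg_one` (Darmon–Diamond–Taylor 1995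
  p. 87) with the final contradiction taken from `M₁` instead of from irreducibility over `A`.
* §2 `exists_prime_jacobiSym_eq_jacobiSym` — Dirichlet primes `ℓ` in a prescribed non-zero class mod `p` COPYING the
  quadratic characters of `p`: `(D₁/ℓ) = (D₁/p)`, `(D₂/ℓ) = (D₂/p)` for two discriminants `D₁, D₂` prime to the
  odd prime `p` (Cox's characters `χ_D : (ℤ/D)ˣ → {±1}`, Lemma 1.14, tree `Quadratic.discrChar`; CRT; Dirichlet).
  The class of `p` itself is the witness, so no independence-of-characters argument is needed.

THEOREMS ONLY (no definition, no named fact, no `sorry`). Supports, does not close, stmt-BirchSwinnertonDyer-20452.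

References: [DarmonDiamondTaylor1995] Thm. 3.1 (b)–(c) and p. 87; [Cox2013] §1.C Lemma 1.14;
[IrelandRosen1990] Ch. 16 §1 Thm. 1 (Dirichlet).
-/

noncomputable section

open scoped Matrix NumberTheorySymbols
open Polynomial Module Literature.NumberTheory.GaloisRepresentations
  Literature.NumberTheory.QuadraticFields.Quadratic Summit.BirchSwinnertonDyer.Rank1Residual

namespace Summit.BirchSwinnertonDyer.BirchSwinnertonDyer.Theorems.BiquadraticEisensteinDescentEisensteinDivisibilityCMInertBadFlatAtOneAbsIrrTools

universe u v

/-! ### §1 A two-element criterion for absolute irreducibility in dimension two -/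

section Criterion

variable {G : Type u} [Group G] [TopologicalSpace G] {A : Type v} [Field A] [TopologicalSpace A]

/-- `scalar a *ᵥ v = a • v`. [folklore] -/
theorem scalar_mulVec_eq_smul {F : Type*} [CommRing F] {n : Type*} [Fintype n] [DecidableEq n]
    (a : F) (v : n → F) : Matrix.scalar n a *ᵥ v = a • v := by
  ext i
  simp [Matrix.scalar_apply, Matrix.mulVec_diagonal]

/-- **Two-element criterion for absolute irreducibility in dimension two** (characteristic `≠ 2`). Let
`ρ : G →ₜ* GL₂(A)` over a field `A` with `2 ≠ 0`. Suppose some `g₃ ∈ G` acts by a matrix `M₃` with `M₃² = 1` and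
`det M₃ = −1` (a non-scalar involution: both eigenlines, for `+1` and `−1`, are defined over `A`), and some
`g₁ ∈ G` acts by a matrix `M₁` whose characteristic polynomial has NO root in `A`. Then `ρ` is absolutely
irreducible (`FramedRep.IsAbsolutelyIrreducible`: irreducible after every base change `f : A →+* B` to a field):
a `G`-stable `B`-line is `M₃`-stable, so it is spanned by an eigenvector of `M₃ ⊗ B`, hence equals a base-changed
eigenline `B · f(v)` of `M₃` (`Matrix.exists_mulVec_eq_smul_of_involutive`, `Matrix.mem_span_of_mulVec_eq_smul`);
then `f(M₁ v) ∈ B · f(v)` forces `M₁ v ∈ A · v` (`mem_span_of_comp_mem_span`), so `v ≠ 0` is an eigenvector of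
`M₁` with an eigenvalue `a ∈ A`, and `charpoly(M₁)(a) = det(a − M₁) = 0` (`Matrix.eval_charpoly`,
`Matrix.exists_mulVec_eq_zero_iff`) — a root in `A`. The argument of Darmon–Diamond–Taylor 1995, p. 87
("if `ℓ` is odd … `ρ̄` is irreducible if and only if it is absolutely irreducible"), with the involution supplied by
any element rather than complex conjugation. [cite: DarmonDiamondTaylor1995, Thm. 3.1 (b)–(c) and p. 87] -/
theorem isAbsolutelyIrreducible_of_involution_of_rootless (ρ : FramedRep G A 2) (h2 : (2 : A) ≠ 0)
    {g₃ g₁ : G}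
    (hMM : ((ρ g₃ : GL (Fin 2) A) : Matrix (Fin 2) (Fin 2) A) *
      ((ρ g₃ : GL (Fin 2) A) : Matrix (Fin 2) (Fin 2) A) = 1)
    (hdet : ((ρ g₃ : GL (Fin 2) A) : Matrix (Fin 2) (Fin 2) A).det = -1)
    (hroot : ∀ a : A, (((ρ g₁ : GL (Fin 2) A) : Matrix (Fin 2) (Fin 2) A).charpoly).eval a ≠ 0) :
    ρ.IsAbsolutelyIrreducible := by
  intro B _ f
  classical
  set M : Matrix (Fin 2) (Fin 2) A := ((ρ g₃ : GL (Fin 2) A) : Matrix (Fin 2) (Fin 2) A) with hM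
  set M₁ : Matrix (Fin 2) (Fin 2) A := ((ρ g₁ : GL (Fin 2) A) : Matrix (Fin 2) (Fin 2) A) with hM₁
  have h2B : (2 : B) ≠ 0 := by
    have : f 2 ≠ 0 := (map_ne_zero f).mpr h2
    rwa [map_ofNat] at this
  -- base-changed matrices
  set ρB := ρ.baseChangeRepresentation f with hρB
  have hρBapply : ∀ (g : G) (x : Fin 2 → B),
      ρB g x = (((ρ g : GL (Fin 2) A) : Matrix (Fin 2) (Fin 2) A).map f) *ᵥ x := fun g x ↦ rfl
  have hmapv : ∀ (g : G) (w : Fin 2 → A),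
      (((ρ g : GL (Fin 2) A) : Matrix (Fin 2) (Fin 2) A).map f) *ᵥ (f ∘ w) =
        f ∘ ((((ρ g : GL (Fin 2) A) : Matrix (Fin 2) (Fin 2) A)) *ᵥ w) := fun g w ↦
    funext fun i ↦ (RingHom.map_mulVec f _ w i).symm
  set MB : Matrix (Fin 2) (Fin 2) B := M.map f with hMB
  have hMBMB : MB * MB = 1 := by
    rw [hMB, ← Matrix.map_mul, hMM, Matrix.map_one _ (map_zero f) (map_one f)]
  -- the subrepresentations of `ρB` form a simple order
  have h2F : finrank B (Fin 2 → B) = 2 := Module.finrank_fin_fun B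
  have hbt : (⊥ : Subrepresentation ρB) ≠ ⊤ := by
    intro h
    have h' : (⊥ : Submodule B (Fin 2 → B)) = ⊤ := congrArg Subrepresentation.toSubmodule h
    exact bot_ne_top h'
  refine { toNontrivial := ⟨⟨⊥, ⊤, hbt⟩⟩, eq_bot_or_eq_top := fun W ↦ ?_ }
  by_contra hW
  push Not at hW
  -- `L = W` is a `G`-stable line of `B²`
  set L : Submodule B (Fin 2 → B) := W.toSubmodule with hL
  have hLbot : L ≠ ⊥ := fun h ↦ hW.1 (Subrepresentation.toSubmodule_injective h)
  have hLtop : L ≠ ⊤ := fun h ↦ hW.2 (Subrepresentation.toSubmodule_injective h)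
  have hL1 : finrank B L = 1 :=
    Literature.RepresentationTheory.FiniteGroups.Representation.finrank_eq_one_of_ne_bot_of_ne_top
      h2F hLbot hLtop
  have hLstab : ∀ (g : G) {x : Fin 2 → B}, x ∈ L →
      (((ρ g : GL (Fin 2) A) : Matrix (Fin 2) (Fin 2) A).map f) *ᵥ x ∈ L := fun g x hx ↦ by
    rw [← hρBapply]
    exact W.apply_mem_toSubmodule g hx
  -- a non-zero vector `w` of `L`, and a non-zero eigenvector `x ∈ L` of `MB` with sign `s`
  haveI : FiniteDimensional B (Fin 2 → B) := inferInstance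
  obtain ⟨w, hwL, hw0⟩ : ∃ w ∈ L, w ≠ 0 := Submodule.exists_mem_ne_zero_of_ne_bot hLbot
  obtain ⟨s, hs, x, hxL, hx0, hMBx⟩ : ∃ s : A, s * s = 1 ∧ ∃ x ∈ L, x ≠ 0 ∧ MB *ᵥ x = f s • x := by
    by_cases hw : MB *ᵥ w + w = 0
    · refine ⟨-1, by ring, w, hwL, hw0, ?_⟩
      rw [map_neg, map_one, neg_one_smul]
      exact eq_neg_of_add_eq_zero_left hw
    · refine ⟨1, by ring, MB *ᵥ w + w, L.add_mem (hLstab g₃ hwL) hwL, hw, ?_⟩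
      rw [map_one, one_smul, Matrix.mulVec_add, Matrix.mulVec_mulVec, hMBMB, Matrix.one_mulVec,
        add_comm]
  -- the `s`-eigenline of `M` is defined over `A`
  obtain ⟨v, hv0, hMv⟩ := Matrix.exists_mulVec_eq_smul_of_involutive hMM hdet h2 hs
  have hfv0 : (f ∘ v) ≠ 0 := by
    intro h
    apply hv0
    funext i
    exact f.injective ((congr_fun h i).trans (map_zero f).symm)
  have hMBfv : MB *ᵥ (f ∘ v) = f s • (f ∘ v) := by
    rw [hMB, hM, hmapv g₃ v, hMv]
    funext i
    simp only [Function.comp_apply, Pi.smul_apply, smul_eq_mul, map_mul]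
  have hdetMB' : MB.det ≠ f s * f s := by
    rw [← map_mul, hs, map_one, hMB, ← RingHom.mapMatrix_apply, ← RingHom.map_det, hdet, map_neg,
      map_one]
    intro h
    apply h2B
    calc (2 : B) = 1 - (-1) := by norm_num
      _ = 0 := by rw [h, sub_self]
  -- hence `x ∈ B · f(v)`, so `f(v) ∈ L` and `L = B · f(v)`
  have hxspan : x ∈ Submodule.span B {f ∘ v} :=
    Matrix.mem_span_of_mulVec_eq_smul hdetMB' hfv0 hMBfv hMBx
  obtain ⟨b, rfl⟩ := Submodule.mem_span_singleton.mp hxspan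
  have hb0 : b ≠ 0 := by
    rintro rfl
    exact hx0 (zero_smul _ _)
  have hfvL : (f ∘ v) ∈ L := by
    have := L.smul_mem b⁻¹ hxL
    rwa [smul_smul, inv_mul_cancel₀ hb0, one_smul] at this
  have hLeq : Submodule.span B {f ∘ v} = L :=
    Literature.RepresentationTheory.FiniteGroups.Representation.eq_of_finrank_eq_one_of_mem
      (finrank_span_singleton hfv0) hL1 hfv0 (Submodule.mem_span_singleton_self _) hfvL
  -- so `v` is an eigenvector of `M₁` over `A`
  have hv₁ : M₁ *ᵥ v ∈ Submodule.span A {v} := by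
    refine mem_span_of_comp_mem_span f hv0 ?_
    rw [hM₁, ← hmapv g₁ v, hLeq]
    exact hLstab g₁ hfvL
  obtain ⟨a, ha⟩ := Submodule.mem_span_singleton.mp hv₁
  -- `a` is a root of the characteristic polynomial of `M₁`
  apply hroot a
  rw [Matrix.eval_charpoly]
  refine (Matrix.exists_mulVec_eq_zero_iff).mp ⟨v, hv0, ?_⟩
  rw [Matrix.sub_mulVec, scalar_mulVec_eq_smul, ← ha, sub_self]

/-- **The same with both elements given through their characteristic polynomials**: `charpoly(M₃) = X² − 1`
(then `M₃² = 1` by Cayley–Hamilton and `det M₃ = −1`) and `charpoly(M₁) = X² − x` with `x` a non-square of `A`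
(rootless). [cite: DarmonDiamondTaylor1995, Thm. 3.1 (b)–(c) and p. 87] -/
theorem isAbsolutelyIrreducible_of_charpoly (ρ : FramedRep G A 2) (h2 : (2 : A) ≠ 0) {g₃ g₁ : G} {x : A}
    (h₃ : ((ρ g₃ : GL (Fin 2) A) : Matrix (Fin 2) (Fin 2) A).charpoly = X ^ 2 - C 0 * X + C (-1))
    (h₁ : ((ρ g₁ : GL (Fin 2) A) : Matrix (Fin 2) (Fin 2) A).charpoly = X ^ 2 - C 0 * X + C (-x))
    (hx : ¬ IsSquare x) : ρ.IsAbsolutelyIrreducible := by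
  have hdet : ((ρ g₃ : GL (Fin 2) A) : Matrix (Fin 2) (Fin 2) A).det = -1 :=
    Matrix.det_eq_of_charpoly_eq h₃
  have hMM : ((ρ g₃ : GL (Fin 2) A) : Matrix (Fin 2) (Fin 2) A) *
      ((ρ g₃ : GL (Fin 2) A) : Matrix (Fin 2) (Fin 2) A) = 1 := by
    have h := Matrix.aeval_self_charpoly ((ρ g₃ : GL (Fin 2) A) : Matrix (Fin 2) (Fin 2) A)
    rw [h₃] at h
    simp only [map_zero, zero_mul, sub_zero, map_add, map_pow, aeval_X, map_neg, map_one] at h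
    rw [sq] at h
    exact eq_of_sub_eq_zero (by rw [sub_eq_add_neg]; exact h)
  have hroot : ∀ a : A, (((ρ g₁ : GL (Fin 2) A) : Matrix (Fin 2) (Fin 2) A).charpoly).eval a ≠ 0 := by
    intro a ha
    apply hx
    rw [h₁] at ha
    simp only [map_zero, zero_mul, sub_zero, eval_add, eval_pow, eval_X, eval_C] at ha
    exact ⟨a, by rw [← sq]; linear_combination -ha⟩
  exact isAbsolutelyIrreducible_of_involution_of_rootless ρ h2 hMM hdet hroot

end Criterion

/-! ### §2 Dirichlet primes copying the quadratic characters of `p` -/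

/-- **Dirichlet primes copying the quadratic characters of `p`.** Let `D₁, D₂` be non-zero integers
`≡ 0, 1 (mod 4)`, `p` an odd prime dividing neither, and `c` a non-zero residue mod `p`. Then there are primes `ℓ`,
beyond any bound, with `ℓ ≡ c (mod p)` and `(D₁/ℓ) = (D₁/p)`, `(D₂/ℓ) = (D₂/p)` (Jacobi symbols): take
`ℓ ≡ p (mod |D₁ D₂|)` — Cox's character `χ_D : (ℤ/D)ˣ → {±1}` has `χ_D([m]) = (D/m)` for odd positive `m`
(Lemma 1.14; tree `Quadratic.discrChar_apply_eq_jacobiSym`) — and `ℓ ≡ c (mod p)` by the Chinese remainder theorem,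
then Dirichlet's theorem on primes in arithmetic progressions (Mathlib `Nat.forall_exists_prime_gt_and_eq_mod`).
[cite: Cox2013, §1.C Lemma 1.14] -/
theorem exists_prime_jacobiSym_eq_jacobiSym {D₁ D₂ : ℤ} (hD₁0 : D₁ ≠ 0)
    (hD₁4 : D₁ % 4 = 0 ∨ D₁ % 4 = 1) (hD₂0 : D₂ ≠ 0) (hD₂4 : D₂ % 4 = 0 ∨ D₂ % 4 = 1)
    {p : ℕ} (hp : p.Prime) (hp2 : p ≠ 2) (hpD₁ : ¬ (p : ℤ) ∣ D₁) (hpD₂ : ¬ (p : ℤ) ∣ D₂)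
    {c : ZMod p} (hc : c ≠ 0) (n : ℕ) :
    ∃ ℓ : ℕ, ℓ.Prime ∧ n < ℓ ∧ p < ℓ ∧ ¬ (ℓ : ℤ) ∣ D₁ ∧ ¬ (ℓ : ℤ) ∣ D₂ ∧ (ℓ : ZMod p) = c ∧
      J(D₁ | ℓ) = J(D₁ | p) ∧ J(D₂ | ℓ) = J(D₂ | p) := by
  haveI : Fact p.Prime := ⟨hp⟩
  haveI : NeZero p := ⟨hp.ne_zero⟩
  -- the modulus `m = |D₁| |D₂|`, prime to `p`
  set m : ℕ := D₁.natAbs * D₂.natAbs with hm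
  have hm0 : m ≠ 0 := mul_ne_zero (Int.natAbs_ne_zero.mpr hD₁0) (Int.natAbs_ne_zero.mpr hD₂0)
  have hpD₁' : p.Coprime D₁.natAbs :=
    (Nat.Prime.coprime_iff_not_dvd hp).mpr fun h ↦ hpD₁ (Int.natCast_dvd.mpr h)
  have hpD₂' : p.Coprime D₂.natAbs :=
    (Nat.Prime.coprime_iff_not_dvd hp).mpr fun h ↦ hpD₂ (Int.natCast_dvd.mpr h)
  have hmp : m.Coprime p := (Nat.Coprime.mul_right hpD₁' hpD₂').symm
  -- the CRT class: `≡ p (mod m)`, `≡ c (mod p)`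
  set c₀ : ℕ := c.val with hc₀
  have hc₀0 : c₀ ≠ 0 := (ZMod.val_ne_zero c).mpr hc
  have hc₀p : c₀ < p := ZMod.val_lt c
  obtain ⟨k, hkm, hkc⟩ := Nat.chineseRemainder hmp p c₀
  have hkm' : k.Coprime m := by
    rw [Nat.Coprime, hkm.gcd_eq]
    exact hmp.symm
  have hkp : k.Coprime p := by
    rw [Nat.Coprime, hkc.gcd_eq]
    exact ((Nat.Prime.coprime_iff_not_dvd hp).mpr
      (Nat.not_dvd_of_pos_of_lt (Nat.pos_of_ne_zero hc₀0) hc₀p)).symm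
  have hkmp : k.Coprime (m * p) := Nat.Coprime.mul_right hkm' hkp
  haveI : NeZero (m * p) := ⟨mul_ne_zero hm0 hp.ne_zero⟩
  obtain ⟨ℓ, hℓn, hℓ, hℓk⟩ :=
    Nat.forall_exists_prime_gt_and_eq_mod ((ZMod.isUnit_iff_coprime k (m * p)).mpr hkmp)
      (max n (max p m))
  simp only [gt_iff_lt, max_lt_iff] at hℓn
  obtain ⟨hnℓ, hpℓ, hmℓ⟩ := hℓn
  have hmod : ℓ ≡ k [MOD m * p] := (ZMod.natCast_eq_natCast_iff ℓ k (m * p)).mp hℓk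
  have hmodm : ℓ ≡ p [MOD m] := (Nat.ModEq.of_mul_right p hmod).trans hkm
  have hmod₁ : ℓ ≡ p [MOD D₁.natAbs] := Nat.ModEq.of_mul_right _ hmodm
  have hmod₂ : ℓ ≡ p [MOD D₂.natAbs] := by
    rw [hm, mul_comm] at hmodm
    exact Nat.ModEq.of_mul_right _ hmodm
  -- sizes
  have hℓD₁ : ¬ (ℓ : ℤ) ∣ D₁ := X12.natCast_not_dvd_of_natAbs_lt hD₁0
    (lt_of_le_of_lt (Nat.le_mul_of_pos_right _ (Int.natAbs_pos.mpr hD₂0)) hmℓ)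
  have hℓD₂ : ¬ (ℓ : ℤ) ∣ D₂ := X12.natCast_not_dvd_of_natAbs_lt hD₂0
    (lt_of_le_of_lt (Nat.le_mul_of_pos_left _ (Int.natAbs_pos.mpr hD₁0)) hmℓ)
  have hℓodd : Odd ℓ := hℓ.odd_of_ne_two (by rintro rfl; exact absurd hpℓ (not_lt.mpr hp.two_le))
  have hpodd : Odd p := hp.odd_of_ne_two hp2
  -- the characters of `D₁`, `D₂` agree on `[ℓ] = [p]`
  have key : ∀ {D : ℤ}, D ≠ 0 → (D % 4 = 0 ∨ D % 4 = 1) → p.Coprime D.natAbs →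
      ℓ ≡ p [MOD D.natAbs] → J(D | ℓ) = J(D | p) := by
    intro D hD0 hD4 hpD hmodD
    set u := ZMod.unitOfCoprime p hpD with hu
    have hup : ((p : ℕ) : ZMod D.natAbs) = u := (ZMod.coe_unitOfCoprime p hpD).symm
    have huℓ : ((ℓ : ℕ) : ZMod D.natAbs) = u := by
      rw [(ZMod.natCast_eq_natCast_iff ℓ p D.natAbs).mpr hmodD, hup]
    rw [← discrChar_apply_eq_jacobiSym hD0 hD4 hℓodd huℓ,
      ← discrChar_apply_eq_jacobiSym hD0 hD4 hpodd hup]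
  refine ⟨ℓ, hℓ, hnℓ, hpℓ, hℓD₁, hℓD₂, ?_, key hD₁0 hD₁4 hpD₁' hmod₁, key hD₂0 hD₂4 hpD₂' hmod₂⟩
  -- `ℓ ≡ c (mod p)`
  rw [(ZMod.natCast_eq_natCast_iff ℓ c₀ p).mpr ((Nat.ModEq.of_mul_left m hmod).trans hkc), hc₀,
    ZMod.natCast_zmod_val]

end Summit.BirchSwinnertonDyer.BirchSwinnertonDyer.Theorems.BiquadraticEisensteinDescentEisensteinDivisibilityCMInertBadFlatAtOneAbsIrrTools

end
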